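import Summits.Ventures.Crystal3D.Bulk.RadiusTwoBarlowHolds
import HarnessLib

/-!
# Cube rigidity I — LOCAL hexagonal layers: disc propagation of one layer and the layer above / below
# (lane T, crux `TextureLiminf`, stmt-Ventures-19483; registered line `TexShadow`, named core `CubeRigidity` of `stub_resolution`)

HONEST FRAMING. Venture `Summits/Ventures/Crystal3D` (cell `crystal3d-full`), helper `--supports` the crux `TextureLiminf`
(stmt-Ventures-19483) of `route-Ventures-StickyWulffConstant`, registered line `TexShadow`.  Rung credit only; F-C1 not moved.
First brick of the kernel proof of `CubeRigidity` (`…TexShadowResolutionDefs`): the LOCAL form of Hales's layer argument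
(*Dense Sphere Packings* §1.3; tree, GLOBAL form: `Literature/…/LayerPropagation.lean`, `LayerStackings.lean`), in Hales's
normalisation (unit balls, contact distance `2`, frame `u₁ u₂ w h e₃` of `LayerShells.lean`), for a packing whose tangent
arrangements are known to be FCC/HCP patterns only on a BALL around the origin.

* `latPt i j = i u₁ + j u₂`; `LayerDisc V c τ τ' n`: every lattice point `c + latPt i j` of ℓ¹-radius `|i| + |j| ≤ n` is a centre
  of `V` with tangent arrangement `layerShell τ τ'`.
* `disc_induction` — ℓ¹-discs of `ℤ²` are generated from `(0,0)` by the four unit moves.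
* `layerDisc_hcp` — an HCP-type centre with shell `layerShell s s` propagates its mirror layer to ℓ¹-radius `n` when the
  arrangements within `2n + 2` are FCC/HCP (`L2B.kissingShell_add_eq_layerShell_of_hcp_hexagon`).
* `layerDisc_fcc` — a centre with a layer shell propagates its layer to ℓ¹-radius `n` when the arrangements within `2n + 2`
  are all FCC (`L2B.ring_of_fcc`).
WHAT THIS IS NOT: not yet the layer above/below, the stacking, no-room or `CubeRigidity` (sequel files); F-C1 not moved.
-/

noncomputable section

namespace Summit.Ventures.Crystal3D.Theorems.LocalStacking

open Literature.Geometry.DiscreteGeometry Literature.MathematicalPhysics.StatisticalMechanics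
open RealInnerProductSpace Summit.Ventures.Crystal3D.L2B


variable {V : Set (EuclideanSpace ℝ (Fin 3))}

/-! ## Lattice points and translated packings -/

/-- The lattice point `i u₁ + j u₂` of the standard layer. -/
def latPt (i j : ℤ) : (EuclideanSpace ℝ (Fin 3)) := (i : ℝ) • (triangularVec₁ (2 : ℝ)) + (j : ℝ) • triangularVec₂ (2 : ℝ)

/-- `latPt (i+1) j = latPt i j + u₁`. -/
theorem latPt_succ_left (i j : ℤ) : latPt (i + 1) j = latPt i j + triangularVec₁ (2 : ℝ) := by
  simp only [latPt]; push_cast; module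

/-- `latPt (i-1) j = latPt i j - u₁`. -/
theorem latPt_pred_left (i j : ℤ) : latPt (i - 1) j = latPt i j + -triangularVec₁ (2 : ℝ) := by
  simp only [latPt]; push_cast; module

/-- `latPt i (j+1) = latPt i j + u₂`. -/
theorem latPt_succ_right (i j : ℤ) : latPt i (j + 1) = latPt i j + triangularVec₂ (2 : ℝ) := by
  simp only [latPt]; push_cast; module

/-- `latPt i (j-1) = latPt i j - u₂`. -/
theorem latPt_pred_right (i j : ℤ) : latPt i (j - 1) = latPt i j + -triangularVec₂ (2 : ℝ) := by
  simp only [latPt]; push_cast; module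

/-- `latPt (i+1) (j-1) = latPt i j + (u₁ - u₂)`. -/
theorem latPt_succ_pred (i j : ℤ) : latPt (i + 1) (j - 1) = latPt i j + (triangularVec₁ (2 : ℝ) - triangularVec₂ (2 : ℝ)) := by
  simp only [latPt]; push_cast; module

/-- `latPt (i-1) (j+1) = latPt i j + (u₂ - u₁)`. -/
theorem latPt_pred_succ (i j : ℤ) : latPt (i - 1) (j + 1) = latPt i j + (triangularVec₂ (2 : ℝ) - triangularVec₁ (2 : ℝ)) := by
  simp only [latPt]; push_cast; module

/-- `latPt 0 0 = 0`. -/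
@[simp] theorem latPt_zero : latPt 0 0 = 0 := by simp [latPt]

/-- `‖latPt i j‖ ≤ 2 (|i| + |j|)`. -/
theorem norm_latPt_le (i j : ℤ) : ‖latPt i j‖ ≤ 2 * (|i| + |j| : ℤ) := by
  have hu : ‖(triangularVec₁ (2 : ℝ))‖ = 2 := norm_of_mem_hexagonSet (by simp [hexagonSet])
  have hv : ‖(triangularVec₂ (2 : ℝ))‖ = 2 := norm_of_mem_hexagonSet (by simp [hexagonSet])
  calc ‖latPt i j‖ ≤ ‖(i : ℝ) • (triangularVec₁ (2 : ℝ))‖ + ‖(j : ℝ) • (triangularVec₂ (2 : ℝ))‖ := norm_add_le _ _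
    _ = 2 * (|i| + |j| : ℤ) := by
        rw [norm_smul, norm_smul, hu, hv, Real.norm_eq_abs, Real.norm_eq_abs]
        push_cast; ring

/-- A translated packing is a packing. -/
theorem isUnitBallPacking_translate (hV : IsUnitBallPacking V) (P : (EuclideanSpace ℝ (Fin 3))) : IsUnitBallPacking {z | P + z ∈ V} := by
  intro x hx y hy hxy
  have h := hV hx hy (by rwa [dist_add_left])
  exact add_left_cancel h

/-- Shells of a translated packing. -/
theorem kissingShell_translate (P y : (EuclideanSpace ℝ (Fin 3))) : kissingShell {z | P + z ∈ V} y = kissingShell V (P + y) := by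
  ext x; simp [kissingShell, add_assoc]

/-! ## ℓ¹-discs of the layer lattice -/

/-- **Disc induction**: a property of lattice indices holding at `(0,0)` and inherited along the four unit moves from every
index of ℓ¹-norm `< n` holds on the whole ℓ¹-disc of radius `n`. -/
theorem disc_induction {Q : ℤ → ℤ → Prop} (n : ℤ) (h0 : Q 0 0)
    (step : ∀ i j : ℤ, |i| + |j| < n → Q i j → Q (i + 1) j ∧ Q (i - 1) j ∧ Q i (j + 1) ∧ Q i (j - 1)) :
    ∀ i j : ℤ, |i| + |j| ≤ n → Q i j := by
  -- induction on the ℓ¹-norm, as a natural number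
  have key : ∀ m : ℕ, (m : ℤ) ≤ n → ∀ i j : ℤ, |i| + |j| ≤ m → Q i j := by
    intro m
    induction m with
    | zero =>
      intro _ i j hij
      have hi : i = 0 := by
        have := abs_nonneg j; rw [← abs_eq_zero]; push_cast at hij; linarith [abs_nonneg i]
      have hj : j = 0 := by
        have := abs_nonneg i; rw [← abs_eq_zero]; push_cast at hij; linarith [abs_nonneg j]
      subst hi hj; exact h0
    | succ m ih =>
      intro hmn i j hij
      have hmn' : (m : ℤ) ≤ n := by push_cast at hmn; linarith
      by_cases hle : |i| + |j| ≤ m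
      · exact ih hmn' i j hle
      have heq : |i| + |j| = m + 1 := by push_cast at hij; omega
      have hlt : ∀ i' j' : ℤ, |i'| + |j'| = m → |i'| + |j'| < n := fun i' j' h => by omega
      rcases lt_trichotomy i 0 with hi | hi | hi
      · -- `i < 0`: come from `(i+1, j)`
        have h1 : |i + 1| + |j| = m := by
          rw [abs_of_neg hi] at heq; rw [abs_of_nonpos (by omega)]; omega
        have := (step (i + 1) j (hlt _ _ h1) (ih hmn' _ _ h1.le)).2.1
        rwa [add_sub_cancel_right] at this
      · -- `i = 0`: move in `j`
        subst hi
        rcases lt_or_gt_of_ne (show j ≠ 0 by rintro rfl; simp at heq; omega) with hj | hj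
        · have h1 : |(0 : ℤ)| + |j + 1| = m := by
            rw [abs_of_neg hj] at heq; rw [abs_zero, abs_of_nonpos (by omega)]; simp at heq ⊢; omega
          have := (step 0 (j + 1) (hlt _ _ h1) (ih hmn' _ _ h1.le)).2.2.2
          rwa [add_sub_cancel_right] at this
        · have h1 : |(0 : ℤ)| + |j - 1| = m := by
            rw [abs_of_pos hj] at heq; rw [abs_zero, abs_of_nonneg (by omega)]; simp at heq ⊢; omega
          have := (step 0 (j - 1) (hlt _ _ h1) (ih hmn' _ _ h1.le)).2.2.1
          rwa [sub_add_cancel] at this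
      · -- `i > 0`: come from `(i-1, j)`
        have h1 : |i - 1| + |j| = m := by
          rw [abs_of_pos hi] at heq; rw [abs_of_nonneg (by omega)]; omega
        have := (step (i - 1) j (hlt _ _ h1) (ih hmn' _ _ h1.le)).1
        rwa [sub_add_cancel] at this
  intro i j hij
  have hn : 0 ≤ n := le_trans (by positivity) hij
  obtain ⟨m, rfl⟩ := Int.eq_ofNat_of_zero_le hn
  exact key m le_rfl i j hij

/-! ## The local layer datum -/

/-- **Local layer datum**: every lattice point `c + latPt i j` with `|i| + |j| ≤ n` is a centre of `V` whose tangent arrangement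
is the layer shell `layerShell τ τ'` (vacuous for `n < 0`). -/
def LayerDisc (V : Set (EuclideanSpace ℝ (Fin 3))) (c : (EuclideanSpace ℝ (Fin 3))) (τ τ' : ℝ) (n : ℤ) : Prop :=
  ∀ i j : ℤ, |i| + |j| ≤ n → c + latPt i j ∈ V ∧ kissingShell V (c + latPt i j) = layerShell τ τ'

/-- A layer datum restricts to smaller discs. -/
theorem LayerDisc.mono {c : (EuclideanSpace ℝ (Fin 3))} {τ τ' : ℝ} {n m : ℤ} (h : LayerDisc V c τ τ' n) (hmn : m ≤ n) :
    LayerDisc V c τ τ' m := fun i j hij => h i j (hij.trans hmn)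

/-! ## Propagation of the base layer -/

/-- **HCP disc.** If `0 ∈ V` has the HCP-type shell `layerShell s s` and every centre of `V` within `2n + 2` of `0` has an FCC
or HCP tangent arrangement, then the mirror layer is present to ℓ¹-radius `n`, all with shell `layerShell s s`. -/
theorem layerDisc_hcp (hV : IsUnitBallPacking V) (h0 : (0 : (EuclideanSpace ℝ (Fin 3))) ∈ V) {s : ℝ} (hs : s = 1 ∨ s = -1)
    (hS0 : kissingShell V 0 = layerShell s s) (n : ℤ)
    (hcp : ∀ u ∈ V, ‖u‖ ≤ 2 * n + 2 → IsArrangedIn (kissingShell V u) fccKissingPattern ∨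
      IsArrangedIn (kissingShell V u) hcpKissingPattern) :
    LayerDisc V 0 s s n := by
  refine disc_induction (Q := fun i j => 0 + latPt i j ∈ V ∧ kissingShell V (0 + latPt i j) = layerShell s s) n
    (by simpa using And.intro h0 hS0) ?_
  intro i j hij ⟨hP, hSP⟩
  -- every hexagon neighbour of `P` is a centre within `2n + 2`
  have go : ∀ η ∈ hexagonSet, 0 + latPt i j + η ∈ V ∧ kissingShell V (0 + latPt i j + η) = layerShell s s := by
    intro η hη
    have hmem : 0 + latPt i j + η ∈ V := (hSP ▸ hexagonSet_subset_layerShell s s hη :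
      η ∈ kissingShell V (0 + latPt i j)).1
    refine kissingShell_add_eq_layerShell_of_hcp_hexagon hV hs hP hSP hη (hcp _ hmem ?_)
    calc ‖0 + latPt i j + η‖ ≤ ‖0 + latPt i j‖ + ‖η‖ := norm_add_le _ _
      _ ≤ 2 * (|i| + |j| : ℤ) + 2 := by rw [zero_add, norm_of_mem_hexagonSet hη]; linarith [norm_latPt_le i j]
      _ ≤ 2 * n + 2 := by
          have : ((|i| + |j| : ℤ) : ℝ) ≤ n := by exact_mod_cast hij.le
          linarith
  refine ⟨?_, ?_, ?_, ?_⟩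
  · rw [latPt_succ_left, ← add_assoc]; exact go _ (by simp [hexagonSet])
  · rw [latPt_pred_left, ← add_assoc]; exact go _ (by simp [hexagonSet])
  · rw [latPt_succ_right, ← add_assoc]; exact go _ (by simp [hexagonSet])
  · rw [latPt_pred_right, ← add_assoc]; exact go _ (by simp [hexagonSet])

/-- **FCC disc.** If `0 ∈ V` has a layer shell `layerShell σ σ'` and every centre of `V` within `2n + 2` of `0` has an FCC
tangent arrangement, then the layer is present to ℓ¹-radius `n`, all with shell `layerShell σ σ'` (the FCC interlocking,
`ring_of_fcc` at every disc point). -/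
theorem layerDisc_fcc (hV : IsUnitBallPacking V) (h0 : (0 : (EuclideanSpace ℝ (Fin 3))) ∈ V) {σ σ' : ℝ} (hσ : σ = 1 ∨ σ = -1)
    (hσ' : σ' = 1 ∨ σ' = -1) (hS0 : kissingShell V 0 = layerShell σ σ') (n : ℤ)
    (hfcc : ∀ u ∈ V, ‖u‖ ≤ 2 * n + 2 → IsArrangedIn (kissingShell V u) fccKissingPattern) :
    LayerDisc V 0 σ σ' n := by
  refine disc_induction (Q := fun i j => 0 + latPt i j ∈ V ∧ kissingShell V (0 + latPt i j) = layerShell σ σ') n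
    (by simpa using And.intro h0 hS0) ?_
  intro i j hij ⟨hP, hSP⟩
  set P : (EuclideanSpace ℝ (Fin 3)) := 0 + latPt i j with hPdef
  -- translate to `P`
  have hW : IsUnitBallPacking {z | P + z ∈ V} := isUnitBallPacking_translate hV P
  have hW0 : (0 : (EuclideanSpace ℝ (Fin 3))) ∈ {z | P + z ∈ V} := by simpa using hP
  have hWS : kissingShell {z | P + z ∈ V} 0 = layerShell σ σ' := by rw [kissingShell_translate, add_zero, hSP]
  have hring := ring_of_fcc hW hW0 hσ hσ' hWS (fun η hη => by
    rw [kissingShell_translate]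
    have hmem : P + η ∈ V := (hSP ▸ hexagonSet_subset_layerShell σ σ' hη : η ∈ kissingShell V P).1
    refine hfcc _ hmem ?_
    calc ‖P + η‖ ≤ ‖P‖ + ‖η‖ := norm_add_le _ _
      _ ≤ 2 * (|i| + |j| : ℤ) + 2 := by
          rw [hPdef, zero_add, norm_of_mem_hexagonSet hη]; linarith [norm_latPt_le i j]
      _ ≤ 2 * n + 2 := by
          have : ((|i| + |j| : ℤ) : ℝ) ≤ n := by exact_mod_cast hij.le
          linarith)
  have go : ∀ η ∈ hexagonSet, P + η ∈ V ∧ kissingShell V (P + η) = layerShell σ σ' := fun η hη =>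
    ⟨(hSP ▸ hexagonSet_subset_layerShell σ σ' hη : η ∈ kissingShell V P).1,
      by rw [← kissingShell_translate]; exact hring η hη⟩
  refine ⟨?_, ?_, ?_, ?_⟩
  · rw [latPt_succ_left, ← add_assoc]; exact go _ (by simp [hexagonSet])
  · rw [latPt_pred_left, ← add_assoc]; exact go _ (by simp [hexagonSet])
  · rw [latPt_succ_right, ← add_assoc]; exact go _ (by simp [hexagonSet])
  · rw [latPt_pred_right, ← add_assoc]; exact go _ (by simp [hexagonSet])

end Summit.Ventures.Crystal3D.Theorems.LocalStacking

end
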